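import Literature.MathematicalPhysics.QuantumFieldTheory.Balaban1983to89.B1GaussNorm331
import Literature.MathematicalPhysics.QuantumFieldTheory.Balaban1983to89.HiggsRescaling

/-!
# `Balaban1983to89.B1GaussNorm339` — T. Bałaban, *(Higgs)₂,₃ quantum fields in a finite volume. I. A lower bound*,
Commun. Math. Phys. **85** (1982) 603–626 [Balaban1982Higgs1]: the RESCALED Gaussian normalisations (3.39)–(3.40)
p. 619 — `Z_k`, `Z_k(A^{(k)})` of (3.31)–(3.32) rewritten on the unit lattice after the canonical rescaling of the
(k+1)-st step (3.38) — TYPED AS PRINTED and PROVED (the Jacobian of the rescaling and the Gaussian evaluation), with the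
printed `2π`-power of (3.40) refuted and repaired

statement-level skeleton of published theorems with citation tags; proofs where landed; nothing here is a claim about the Yang–Mills mass gap

PDF held: `paper:balaban1982-cmp85-higgs23-i` (journal page = PDF page + 602); the displays were read on the x2 renders
`run/shared/lean/pub/pub-balaban/b2b-balaban-ref1/pages/1982-cmp85-higgs23-I/1982-cmp85-higgs23-I-p017-x2.png` (p. 619)
and `…-p015-x2.png` (p. 617), READ AS IMAGES.

CITATION HEADER (lean-in-tree rule).  WHAT IS REPRODUCED, verbatim, p. 619 [PDF 17] (the text after the rescaled
integral (3.38) *"transforms into the integral const χ_{k+1}(B)χ_{k+1}(ψ)∫dA∫dφ χ_k(A)χ_k(φ) exp[… + log Z_k +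
log Z_k(A^{(k)}) + 𝒫^{(k)}(A^{(k)}, φ) − E₀]"*): *"where now
Z_k = (a_k(L^kε)^{d−2}/2π)^{(d/2)|T₁^{(k)}|} (L^kε)^{−(d(d−2)/2)|T₁|} ∫dA exp(−½⟨A, G_k⁻¹A⟩), (3.39)
Z_k(A^{(k)}) = (a_k(L^kε)^{d−2}/2π)^{(N/2)|T₁^{(k)}|} (L^kε)^{−(N(d−2)/2)|T₁|} ∫dφ exp(−½⟨φ, G_k(A^{(k)})⁻¹φ⟩)
 = (a_k(L^kε)^{d−2}/2π)^{(N/2)|T₁^{(k)}|} (L^kε)^{−(N(d−2)/2)|T₁|} (2πη^d)^{−½N|T₁|} (det G_k(A^{(k)})⁻¹)^{−1/2}. (3.40)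
The second formula for Z_k(A^{(k)}) will be used in the sequel."* — SKELETON row **B1.Eq3.39-3.40** (reader r12,
`lit-balaban-r12/ROWS-B1-part2.md`: «absent · Gaussian determinant formula»), taken by Phase-2 seat p12 (gen 2) under
ruling G.5-34(d) (SPARE list exhausted ⇒ most-depended ABSENT rows; TAKING line HOME/STATUS.md 2026-08-21T01:03Z).

THE READING (two lattices — the print distinguishes them and so does this file).  `|T₁^{(k)}|` = the number of sites of
the COARSE unit lattice `T₁^{(k)}` (it enters only through the printed prefactor, exponent `(d/2)|T₁^{(k)}|` resp.
`(N/2)|T₁^{(k)}|`) ↦ a natural number `nc`; `|T₁|` = the number of sites of the FINE lattice (`T₁ = ε⁻¹T_ε`, the same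
sites as `T_ε` of (3.31)–(3.32) and as the `η`-lattice `T_η`, `η = L^{−k}`, of (3.38)–(3.40)) ↦ a finite type `T`; the
integration variables `A : T × Fin d → ℝ` (`d|T₁|` reals), `φ : T × Fin N → ℝ` (`N|T₁|` reals), `dA`, `dφ` = Lebesgue
measure; the scalar product of the `η`-lattice `⟨φ, ψ⟩ = Σ_{x∈T_η} η^d φ(x)·ψ(x)` (B1 (1.5) p. 604; the tree's
`HiggsLattice` convention `Σ_x mesh^d ⟪·,·⟫`) ↦ `pairing η d`; the operators `G_k⁻¹`, `G_k(A^{(k)})⁻¹` ↦ their MATRICES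
`Mη`, `MAη` in the site/component coordinates (acting by `*ᵥ`; `det G_k(A^{(k)})⁻¹ = det MAη`, the determinant of the
operator); `a_k(L^kε)^{d−2}` ↦ `B1RT.prec ak ℓ d`, `ℓ = L^kε`.  The link (3.31) ↔ (3.39): the canonical rescaling (1.22)
p. 607 from the `ε`-lattice to the `η = ε/(L^kε)`-lattice, `A(x) = (L^kε)^{−(d−2)/2}A′(x/(L^kε))` (the tree's
`HiggsRescaling.rescaleScalar`/`rescaleVec` with `s = (L^kε)⁻¹`, cf. `rescaleScalar_factor` below), under which
`⟨A, M_ε A⟩_ε = ⟨A′, M_η A′⟩_η` with `M_η = (L^kε)² M_ε` (an inverse propagator has dimension length⁻²: `−Δ^ε ↦ −Δ^η`,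
`m² ↦ m²(L^kε)²`, `a_k(L^kε)⁻²P_k ↦ a_kP_k`, cf. (3.52) p. 621) and `dA = (L^kε)^{−((d−2)/2)·d|T₁|} dA′`.

WHAT THIS FILE PROVES (kernel-checked, 0 `sorry`, standard axioms; the Gaussian integral is the tree's KERNEL theorem
`Beta.GaussianIntegral.integral_exp_neg_half_quadForm`, the change of variables is Mathlib's
`MeasureTheory.Measure.integral_comp_inv_smul_of_nonneg` — BY NAME):
* §1 `pairing`, `gaussInt η d M = ∫dφ exp(−½⟨φ, Mφ⟩_η)`; **`gaussInt_eq`**: `= (2π/η^d)^{|ι|/2}/√(det M)` (`η > 0`, `M`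
  positive definite); **`gaussInt_rescale`**: `gaussInt ε d M = ℓ^{−((d−2)/2)|ι|} · gaussInt (ε/ℓ) d (ℓ²M)` (`ℓ > 0`; THE
  JACOBIAN OF THE CANONICAL RESCALING).
* §2 (3.31)/(3.32) in the two-lattice reading `Zeps`/`ZAeps` (dictionary `Zk_eq_Zeps`/`ZkA_eq_ZAeps` to the one-type
  decls `B1GaussNorm331.Zk`/`ZkA` of row B1.Eq3.31-3.32); (3.39) `Zeta`, (3.40) first line `ZAeta` AS PRINTED;
  **`eq339`**/**`eq339'`**, **`eq340a`**/**`eq340a'`**: (3.31) = (3.39) and (3.32) = (3.40)₁ (PROVED, both directions of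
  the dictionary `M_η = ℓ²M_ε`, `η = ε/ℓ`).
* §3 (3.40) second line: **`eq340`** PROVED in the REPAIRED form `… (2π/η^d)^{½N|T₁|} (det MAη)^{−1/2}`; the display AS
  PRINTED `Eq340Printed` (factor `(2πη^d)^{−½N|T₁|}`) is REFUTED, **`not_eq340Printed`**, for every admissible datum with
  `N|T₁| ≥ 1` (the two right sides differ by the factor `(2π)^{N|T₁|}`): a PRINT SLIP in the sign of the exponent of `2π`
  (the `η`-power `η^{−dN|T₁|/2}` is right; no normalisation of `dφ` or reading of `det` produces `(2π)^{−N|T₁|/2}`),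
  harmless in the sequel, which uses (3.40) only through determinant RATIOS ((3.46)–(3.47) p. 620).  Cell convention
  (LEAN-PLAN §5.1): row status «proved (repaired 2π-power) · refuted-as-printed»; transcript note in HOME/GAPS.md.
* §4 `log_ZAeta` (the constant `log Z_k(A^{(k)})` of (3.38) in closed form), `Zeta_eq` (the same evaluation for (3.39)),
  and the dictionary `rescaleScalar_factor` to the (1.22) carrier of record.
HONEST SCOPE.  (i) `Mη`, `MAη` (equivalently `M_ε = ℓ⁻²M_η`) are arguments: the operators `G_k = G_k(T^{(k)}, 0)`,
`G_k(A^{(k)})` of (2.28)/(3.15)–(3.16) and their positivity (Prop. 2.2/2.3) are not constructed here — exactly as in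
`B1GaussNorm331` (row B1.Eq3.31-3.32).  (ii) The one-type decls `B1GaussNorm331.Zk`/`ZkA` are the special reading
`nc = |T|`, weight `ε^d = 1` of `Zeps`/`ZAeps` (`Zk_eq_Zeps`); (3.39)–(3.40) need the two cardinalities apart.
(iii) No claim beyond the displayed algebra/analysis of (3.39)–(3.40).
Unit `lit-balaban-p12-g2` (Phase-2 seat p12, gen 2), HOME `run/shared/lean/pub/lit-balaban/` (seat log
`lit-balaban-p12/STATUS.md`).
-/

noncomputable section

open MeasureTheory Matrix Finset
open scoped Real

namespace Literature.MathematicalPhysics.QuantumFieldTheory.Balaban1983to89.B1GaussNorm339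

open Literature.MathematicalPhysics.QuantumFieldTheory.Balaban1983to89

/-! ## §1 The `η`-lattice pairing, the Gaussian fluctuation integral, its closed form and its rescaling -/

section Generic

variable {ι : Type*} [Fintype ι] [DecidableEq ι]

omit [DecidableEq ι] in
/-- the scalar product of the lattice of spacing `η` in dimension `d`: `⟨φ, ψ⟩ = Σ_x η^d φ(x)ψ(x)` (B1 (1.5) p. 604, on the
coordinates `ι` of the field). [cite: Balaban1982Higgs1, (3.39)–(3.40) p.619] -/
def pairing (η : ℝ) (d : ℕ) (φ ψ : ι → ℝ) : ℝ := η ^ d * (φ ⬝ᵥ ψ)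

omit [DecidableEq ι] in
/-- the Gaussian fluctuation integral of (3.39)/(3.40): `∫dφ exp(−½⟨φ, Mφ⟩_η)` over `ι → ℝ` (Lebesgue), `M` the matrix
of the operator `G⁻¹` in the coordinates `ι`. [cite: Balaban1982Higgs1, (3.39)–(3.40) p.619] -/
def gaussInt (η : ℝ) (d : ℕ) (M : Matrix ι ι ℝ) : ℝ :=
  ∫ v : ι → ℝ, Real.exp (-(1 / 2 : ℝ) * pairing η d v (M *ᵥ v))

omit [DecidableEq ι] in
/-- `⟨v, Mv⟩_η = vᵀ(η^dM)v`: the lattice weight is a scalar factor of the form. [cite: Balaban1982Higgs1, (3.39)–(3.40) p.619] -/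
theorem pairing_mulVec (η : ℝ) (d : ℕ) (M : Matrix ι ι ℝ) (v : ι → ℝ) :
    pairing η d v (M *ᵥ v) = v ⬝ᵥ (η ^ d • M) *ᵥ v := by
  rw [pairing, smul_mulVec, dotProduct_smul, smul_eq_mul]

omit [DecidableEq ι] in
/-- `gaussInt η d M` is the plain Gaussian integral of the form `η^dM`. [cite: Balaban1982Higgs1, (3.39)–(3.40) p.619] -/
theorem gaussInt_eq_integral_smul (η : ℝ) (d : ℕ) (M : Matrix ι ι ℝ) :
    gaussInt η d M = ∫ v : ι → ℝ, Real.exp (-(1 / 2 : ℝ) * (v ⬝ᵥ (η ^ d • M) *ᵥ v)) := by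
  simp_rw [gaussInt, pairing_mulVec]

/-- the Gaussian weight of (3.39)/(3.40) is integrable for `η > 0` and a positive definite `M` (a genuine Lebesgue
integral, not a junk value). [cite: Balaban1982Higgs1, (3.39)–(3.40) p.619] -/
theorem gaussInt_integrable {η : ℝ} (hη : 0 < η) (d : ℕ) {M : Matrix ι ι ℝ} (hM : M.PosDef) :
    Integrable (fun v : ι → ℝ => Real.exp (-(1 / 2 : ℝ) * pairing η d v (M *ᵥ v))) := by
  simp_rw [pairing_mulVec]
  exact Beta.GaussianIntegral.integrable_exp_neg_half_quadForm _ (hM.smul (pow_pos hη d))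

/-- **THE GAUSSIAN EVALUATION behind (3.40)**: `∫dφ exp(−½⟨φ, Mφ⟩_η) = (2π/η^d)^{|ι|/2} / √(det M)` for `η > 0` and `M`
positive definite — `(2π)` to the POSITIVE power `|ι|/2`, `η^d` to the negative power. [cite: Balaban1982Higgs1, (3.40) p.619] -/
theorem gaussInt_eq {η : ℝ} (hη : 0 < η) (d : ℕ) {M : Matrix ι ι ℝ} (hM : M.PosDef) :
    gaussInt η d M = (2 * π / η ^ d) ^ ((Fintype.card ι : ℝ) / 2) / Real.sqrt M.det := by
  have hc : (0 : ℝ) < η ^ d := pow_pos hη d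
  have h2π : (0 : ℝ) ≤ 2 * π := by positivity
  rw [gaussInt_eq_integral_smul, Beta.GaussianIntegral.integral_exp_neg_half_quadForm (η ^ d • M) (hM.smul hc),
    det_smul, Real.sqrt_mul (pow_nonneg hc.le _)]
  have e1 : Real.sqrt (2 * π) ^ Fintype.card ι = (2 * π) ^ ((Fintype.card ι : ℝ) / 2) := by
    rw [Real.sqrt_eq_rpow, ← Real.rpow_natCast, ← Real.rpow_mul h2π]
    ring_nf
  have e2 : Real.sqrt ((η ^ d) ^ Fintype.card ι) = (η ^ d) ^ ((Fintype.card ι : ℝ) / 2) := by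
    rw [Real.sqrt_eq_rpow, ← Real.rpow_natCast, ← Real.rpow_mul hc.le]
    ring_nf
  rw [e1, e2, Real.div_rpow h2π hc.le, div_div]

omit [DecidableEq ι] in
/-- **THE JACOBIAN OF THE CANONICAL RESCALING behind (3.39)**: substituting `v = ℓ^{−(d−2)/2} w` (B1 (1.22) with
`s = ℓ⁻¹`, `ℓ = L^kε`) in `∫dv exp(−½⟨v, Mv⟩_ε)` gives `ℓ^{−((d−2)/2)|ι|} ∫dw exp(−½⟨w, (ℓ²M)w⟩_{ε/ℓ})` — the factor
`(L^kε)^{−(d(d−2)/2)|T₁|}` resp. `(L^kε)^{−(N(d−2)/2)|T₁|}` of (3.39)/(3.40) for `|ι| = d|T₁|` resp. `N|T₁|`.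
[cite: Balaban1982Higgs1, (3.39) p.619] -/
theorem gaussInt_rescale (ε : ℝ) {ℓ : ℝ} (hℓ : 0 < ℓ) (d : ℕ) (M : Matrix ι ι ℝ) :
    gaussInt ε d M
      = ℓ ^ (-(((d : ℝ) - 2) / 2) * (Fintype.card ι : ℝ)) * gaussInt (ε / ℓ) d (ℓ ^ 2 • M) := by
  -- `c = ℓ^{(d−2)/2}`, the inverse of the rescaling factor
  set c : ℝ := ℓ ^ (((d : ℝ) - 2) / 2) with hc_def
  have hc : 0 < c := Real.rpow_pos_of_pos hℓ _
  have hcn : (0 : ℝ) < c ^ Fintype.card ι := pow_pos hc _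
  -- Mathlib's change of variables `∫ f(c⁻¹ • x) dx = c^{dim} ∫ f(x) dx` on the add-Haar measure `volume` of `ι → ℝ`
  have hcv := MeasureTheory.Measure.integral_comp_inv_smul_of_nonneg (volume : Measure (ι → ℝ))
    (fun v : ι → ℝ => Real.exp (-(1 / 2 : ℝ) * pairing ε d v (M *ᵥ v))) hc.le
  rw [Module.finrank_fintype_fun_eq_card, smul_eq_mul] at hcv
  have key : gaussInt ε d M
      = (c ^ Fintype.card ι)⁻¹
        * ∫ x : ι → ℝ, Real.exp (-(1 / 2 : ℝ) * pairing ε d (c⁻¹ • x) (M *ᵥ (c⁻¹ • x))) := by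
    rw [hcv, ← mul_assoc, inv_mul_cancel₀ hcn.ne', one_mul]
    rfl
  -- the two scalar identities: `(c^{|ι|})⁻¹ = ℓ^{−((d−2)/2)|ι|}` and `ε^d c⁻² = (ε/ℓ)^d ℓ²`
  have hpow : (c ^ Fintype.card ι)⁻¹ = ℓ ^ (-(((d : ℝ) - 2) / 2) * (Fintype.card ι : ℝ)) := by
    rw [hc_def, ← Real.rpow_natCast, ← Real.rpow_mul hℓ.le, ← Real.rpow_neg hℓ.le, neg_mul]
  have hcc : c * c = ℓ ^ d / ℓ ^ 2 := by
    rw [hc_def, ← Real.rpow_add hℓ, show ((d : ℝ) - 2) / 2 + ((d : ℝ) - 2) / 2 = (d : ℝ) - 2 by ring,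
      Real.rpow_sub hℓ, Real.rpow_natCast, Real.rpow_two]
  have hℓd : (0 : ℝ) < ℓ ^ d := pow_pos hℓ d
  rw [key, hpow]
  congr 1
  unfold gaussInt
  congr 1
  funext w
  congr 2
  unfold pairing
  rw [mulVec_smul, dotProduct_smul, smul_dotProduct, smul_mulVec, dotProduct_smul]
  simp only [smul_eq_mul]
  set X : ℝ := w ⬝ᵥ M *ᵥ w
  calc ε ^ d * (c⁻¹ * (c⁻¹ * X)) = ε ^ d * X / (c * c) := by
        field_simp
    _ = (ε / ℓ) ^ d * (ℓ ^ 2 * X) := by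
        rw [hcc, div_pow]
        field_simp

end Generic

/-! ## §2 (3.31)/(3.32) with the two lattices apart, (3.39) and (3.40) first line as printed, and (3.31) = (3.39),
(3.32) = (3.40)₁ by the canonical rescaling -/

section Printed

variable {T : Type*} [Fintype T] [DecidableEq T]

omit [DecidableEq T] in
/-- **(3.31)** p. 617 in the two-lattice reading: `Z_k = (a_k(L^kε)^{d−2}/2π)^{(d/2)|T₁^{(k)}|} ∫dA exp(−½⟨A, (G^ε_k)⁻¹A⟩)`,
exponent counting the `nc = |T₁^{(k)}|` COARSE sites, the integral over the vector field `A : T × Fin d → ℝ` on the FINE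
sites `T` with the `ε`-lattice pairing, `Mε` the matrix of `(G^ε_k)⁻¹`. [cite: Balaban1982Higgs1, (3.31) p.617] -/
def Zeps (d nc : ℕ) (ak ℓ ε : ℝ) (Mε : Matrix (T × Fin d) (T × Fin d) ℝ) : ℝ :=
  (B1RT.prec ak ℓ d / (2 * π)) ^ ((d : ℝ) / 2 * (nc : ℝ)) * gaussInt ε d Mε

omit [DecidableEq T] in
/-- **(3.32)** p. 617 in the two-lattice reading: `Z_k(A^{(k),ε}) = (a_k(L^kε)^{d−2}/2π)^{(N/2)|T₁^{(k)}|}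
∫dφ exp(−½⟨φ, (G^ε_k(A^{(k),ε}))⁻¹φ⟩)`, `φ : T × Fin N → ℝ`, `MAε` the matrix of `(G^ε_k(A^{(k),ε}))⁻¹`.
[cite: Balaban1982Higgs1, (3.32) p.617] -/
def ZAeps (d N nc : ℕ) (ak ℓ ε : ℝ) (MAε : Matrix (T × Fin N) (T × Fin N) ℝ) : ℝ :=
  (B1RT.prec ak ℓ d / (2 * π)) ^ ((N : ℝ) / 2 * (nc : ℝ)) * gaussInt ε d MAε

omit [DecidableEq T] in
/-- **(3.39)** p. 619, verbatim: *"Z_k = (a_k(L^kε)^{d−2}/2π)^{(d/2)|T₁^{(k)}|} (L^kε)^{−(d(d−2)/2)|T₁|} ∫dA exp(−½⟨A, G_k⁻¹A⟩)"*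
— `ℓ = L^kε`, `nc = |T₁^{(k)}|`, `|T₁| = |T|`, the integral over `A : T × Fin d → ℝ` with the `η`-lattice pairing, `Mη` the
matrix of `G_k⁻¹`. [cite: Balaban1982Higgs1, (3.39) p.619] -/
def Zeta (d nc : ℕ) (ak ℓ η : ℝ) (Mη : Matrix (T × Fin d) (T × Fin d) ℝ) : ℝ :=
  (B1RT.prec ak ℓ d / (2 * π)) ^ ((d : ℝ) / 2 * (nc : ℝ))
    * ℓ ^ (-((d : ℝ) * ((d : ℝ) - 2) / 2) * (Fintype.card T : ℝ)) * gaussInt η d Mη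

omit [DecidableEq T] in
/-- **(3.40), first line** p. 619, verbatim: *"Z_k(A^{(k)}) = (a_k(L^kε)^{d−2}/2π)^{(N/2)|T₁^{(k)}|} (L^kε)^{−(N(d−2)/2)|T₁|}
∫dφ exp(−½⟨φ, G_k(A^{(k)})⁻¹φ⟩)"* — `φ : T × Fin N → ℝ`, `MAη` the matrix of `G_k(A^{(k)})⁻¹`.
[cite: Balaban1982Higgs1, (3.40) p.619] -/
def ZAeta (d N nc : ℕ) (ak ℓ η : ℝ) (MAη : Matrix (T × Fin N) (T × Fin N) ℝ) : ℝ :=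
  (B1RT.prec ak ℓ d / (2 * π)) ^ ((N : ℝ) / 2 * (nc : ℝ))
    * ℓ ^ (-((N : ℝ) * ((d : ℝ) - 2) / 2) * (Fintype.card T : ℝ)) * gaussInt η d MAη

omit [DecidableEq T] in
/-- dictionary: the one-type decl `B1GaussNorm331.Zk` of row B1.Eq3.31-3.32 is `Zeps` with `nc = |T|` and lattice weight
`1` (its `Ginv` "absorbs the weight"). [cite: Balaban1982Higgs1, (3.31) p.617] -/
theorem Zk_eq_Zeps (d : ℕ) (ak ℓ : ℝ) (Ginv : Matrix (T × Fin d) (T × Fin d) ℝ) :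
    B1GaussNorm331.Zk d ak ℓ Ginv = Zeps d (Fintype.card T) ak ℓ 1 Ginv := by
  simp only [B1GaussNorm331.Zk, Zeps, gaussInt, pairing, one_pow, one_mul]

omit [DecidableEq T] in
/-- dictionary: `B1GaussNorm331.ZkA` is `ZAeps` with `nc = |T|` and lattice weight `1`. [cite: Balaban1982Higgs1, (3.32) p.617] -/
theorem ZkA_eq_ZAeps (d N : ℕ) (ak ℓ : ℝ) (GinvA : Matrix (T × Fin N) (T × Fin N) ℝ) :
    B1GaussNorm331.ZkA d N ak ℓ GinvA = ZAeps d N (Fintype.card T) ak ℓ 1 GinvA := by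
  simp only [B1GaussNorm331.ZkA, ZAeps, gaussInt, pairing, one_pow, one_mul]

omit [DecidableEq T] in
/-- **(3.31) = (3.39)** (*"where now Z_k = …"*): under the canonical rescaling from the `ε`-lattice to the `η = ε/ℓ`-lattice
(`ℓ = L^kε`; form matrix `M_η = ℓ²M_ε`) the number `Z_k` of (3.31) takes the printed form (3.39), the Jacobian being
`(L^kε)^{−(d(d−2)/2)|T₁|}`.  PROVED. [cite: Balaban1982Higgs1, (3.39) p.619] -/
theorem eq339 (d nc : ℕ) (ak ε : ℝ) {ℓ : ℝ} (hℓ : 0 < ℓ) (Mε : Matrix (T × Fin d) (T × Fin d) ℝ) :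
    Zeps d nc ak ℓ ε Mε = Zeta d nc ak ℓ (ε / ℓ) (ℓ ^ 2 • Mε) := by
  have hexp : -(((d : ℝ) - 2) / 2) * (Fintype.card (T × Fin d) : ℝ)
      = -((d : ℝ) * ((d : ℝ) - 2) / 2) * (Fintype.card T : ℝ) := by
    rw [Fintype.card_prod, Fintype.card_fin]
    push_cast
    ring
  rw [Zeps, Zeta, gaussInt_rescale ε hℓ d Mε, hexp, mul_assoc]

omit [DecidableEq T] in
/-- **(3.31) = (3.39)**, read from the `η`-lattice datum: for the matrix `Mη` of `G_k⁻¹` on the `η`-lattice, the `ε = ℓη`-lattice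
form `ℓ⁻²Mη` of (3.31) has the same normalisation. [cite: Balaban1982Higgs1, (3.39) p.619] -/
theorem eq339' (d nc : ℕ) (ak η : ℝ) {ℓ : ℝ} (hℓ : 0 < ℓ) (Mη : Matrix (T × Fin d) (T × Fin d) ℝ) :
    Zeta d nc ak ℓ η Mη = Zeps d nc ak ℓ (ℓ * η) ((ℓ ^ 2)⁻¹ • Mη) := by
  have h2 : (ℓ ^ 2) ≠ 0 := pow_ne_zero 2 hℓ.ne'
  rw [eq339 d nc ak (ℓ * η) hℓ, smul_smul, mul_inv_cancel₀ h2, one_smul, mul_div_cancel_left₀ η hℓ.ne']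

omit [DecidableEq T] in
/-- **(3.32) = (3.40), first line**: the same rescaling for `Z_k(A^{(k)})` (`N`-component field, Jacobian
`(L^kε)^{−(N(d−2)/2)|T₁|}`).  PROVED. [cite: Balaban1982Higgs1, (3.40) p.619] -/
theorem eq340a (d N nc : ℕ) (ak ε : ℝ) {ℓ : ℝ} (hℓ : 0 < ℓ) (MAε : Matrix (T × Fin N) (T × Fin N) ℝ) :
    ZAeps d N nc ak ℓ ε MAε = ZAeta d N nc ak ℓ (ε / ℓ) (ℓ ^ 2 • MAε) := by
  have hexp : -(((d : ℝ) - 2) / 2) * (Fintype.card (T × Fin N) : ℝ)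
      = -((N : ℝ) * ((d : ℝ) - 2) / 2) * (Fintype.card T : ℝ) := by
    rw [Fintype.card_prod, Fintype.card_fin]
    push_cast
    ring
  rw [ZAeps, ZAeta, gaussInt_rescale ε hℓ d MAε, hexp, mul_assoc]

omit [DecidableEq T] in
/-- **(3.32) = (3.40)₁**, read from the `η`-lattice datum `MAη` (matrix of `G_k(A^{(k)})⁻¹`). [cite: Balaban1982Higgs1, (3.40) p.619] -/
theorem eq340a' (d N nc : ℕ) (ak η : ℝ) {ℓ : ℝ} (hℓ : 0 < ℓ) (MAη : Matrix (T × Fin N) (T × Fin N) ℝ) :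
    ZAeta d N nc ak ℓ η MAη = ZAeps d N nc ak ℓ (ℓ * η) ((ℓ ^ 2)⁻¹ • MAη) := by
  have h2 : (ℓ ^ 2) ≠ 0 := pow_ne_zero 2 hℓ.ne'
  rw [eq340a d N nc ak (ℓ * η) hℓ, smul_smul, mul_inv_cancel₀ h2, one_smul, mul_div_cancel_left₀ η hℓ.ne']

/-! ## §3 (3.40), second line: the Gaussian determinant formula — PROVED as repaired, REFUTED as printed -/

/-- **(3.40), second line — REPAIRED AND PROVED**: for `η > 0` and `G_k(A^{(k)})⁻¹` positive definite,
`Z_k(A^{(k)}) = (a_k(L^kε)^{d−2}/2π)^{(N/2)|T₁^{(k)}|} (L^kε)^{−(N(d−2)/2)|T₁|} (2π/η^d)^{½N|T₁|} (det G_k(A^{(k)})⁻¹)^{−1/2}`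
(the print has `(2πη^d)^{−½N|T₁|}` for the third factor: see `Eq340Printed`/`not_eq340Printed`).
[cite: Balaban1982Higgs1, (3.40) p.619] -/
theorem eq340 (d N nc : ℕ) (ak ℓ : ℝ) {η : ℝ} (hη : 0 < η) {MAη : Matrix (T × Fin N) (T × Fin N) ℝ}
    (hM : MAη.PosDef) :
    ZAeta d N nc ak ℓ η MAη
      = (B1RT.prec ak ℓ d / (2 * π)) ^ ((N : ℝ) / 2 * (nc : ℝ))
        * ℓ ^ (-((N : ℝ) * ((d : ℝ) - 2) / 2) * (Fintype.card T : ℝ))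
        * (2 * π / η ^ d) ^ ((N : ℝ) / 2 * (Fintype.card T : ℝ)) * MAη.det ^ (-(1 / 2 : ℝ)) := by
  have hexp : ((Fintype.card (T × Fin N) : ℝ) / 2) = (N : ℝ) / 2 * (Fintype.card T : ℝ) := by
    rw [Fintype.card_prod, Fintype.card_fin]
    push_cast
    ring
  have hsq : ∀ x : ℝ, x / Real.sqrt MAη.det = x * MAη.det ^ (-(1 / 2 : ℝ)) := fun x => by
    rw [Real.sqrt_eq_rpow, Real.rpow_neg hM.det_pos.le, div_eq_mul_inv]
  rw [ZAeta, gaussInt_eq hη d hM, hexp, hsq]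
  ring

omit [DecidableEq T] in
/-- **(3.40), second line, AS PRINTED** p. 619: *"= (a_k(L^kε)^{d−2}/2π)^{(N/2)|T₁^{(k)}|} (L^kε)^{−(N(d−2)/2)|T₁|}
(2πη^d)^{−½N|T₁|} (det G_k(A^{(k)})⁻¹)^{−1/2}"* — typed literally as a `Prop` (third factor `(2πη^d)^{−½N|T₁|}`); it is
REFUTED below. [cite: Balaban1982Higgs1, (3.40) p.619] -/
def Eq340Printed (d N nc : ℕ) (ak ℓ η : ℝ) (MAη : Matrix (T × Fin N) (T × Fin N) ℝ) : Prop :=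
  ZAeta d N nc ak ℓ η MAη
    = (B1RT.prec ak ℓ d / (2 * π)) ^ ((N : ℝ) / 2 * (nc : ℝ))
      * ℓ ^ (-((N : ℝ) * ((d : ℝ) - 2) / 2) * (Fintype.card T : ℝ))
      * (2 * π * η ^ d) ^ (-((N : ℝ) / 2 * (Fintype.card T : ℝ))) * MAη.det ^ (-(1 / 2 : ℝ))

omit [DecidableEq T] in
/-- the printed and the true third factor of (3.40) differ by `(2π)^{N|T₁|}`:
`(2π/η^d)^{½N|T₁|} = (2π)^{N|T₁|} · (2πη^d)^{−½N|T₁|}` (`η > 0`). [cite: Balaban1982Higgs1, (3.40) p.619] -/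
theorem factor340_eq (d N : ℕ) {η : ℝ} (hη : 0 < η) :
    (2 * π / η ^ d) ^ ((N : ℝ) / 2 * (Fintype.card T : ℝ))
      = (2 * π) ^ ((N : ℝ) * (Fintype.card T : ℝ))
        * (2 * π * η ^ d) ^ (-((N : ℝ) / 2 * (Fintype.card T : ℝ))) := by
  have hc : (0 : ℝ) < η ^ d := pow_pos hη d
  have h2π : (0 : ℝ) < 2 * π := by positivity
  set m : ℝ := (N : ℝ) / 2 * (Fintype.card T : ℝ) with hm
  have hsq : (2 * π) ^ ((N : ℝ) * (Fintype.card T : ℝ)) = ((2 * π) ^ 2) ^ m := by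
    rw [← Real.rpow_natCast (2 * π) 2, ← Real.rpow_mul h2π.le]
    congr 1
    push_cast
    ring
  rw [hsq, Real.rpow_neg (mul_pos h2π hc).le, ← Real.inv_rpow (mul_pos h2π hc).le,
    ← Real.mul_rpow (sq_nonneg _) (inv_pos.2 (mul_pos h2π hc)).le]
  congr 1
  field_simp

/-- **(3.40), second line, AS PRINTED, IS FALSE** for every admissible datum (`a_k, L^kε, η > 0`, `G_k(A^{(k)})⁻¹` positive
definite, at least one integration variable: `N ≥ 1`, `T₁ ≠ ∅`): by `eq340` and `factor340_eq` the printed right side is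
the true value divided by `(2π)^{N|T₁|} > 1`.  (Print slip in the sign of the exponent of `2π`; the `η`-power is right.)
[cite: Balaban1982Higgs1, (3.40) p.619] -/
theorem not_eq340Printed (d : ℕ) {N : ℕ} (hN : 0 < N) (nc : ℕ) {ak ℓ η : ℝ} (hak : 0 < ak) (hℓ : 0 < ℓ)
    (hη : 0 < η) [Nonempty T] {MAη : Matrix (T × Fin N) (T × Fin N) ℝ} (hM : MAη.PosDef) :
    ¬ Eq340Printed d N nc ak ℓ η MAη := by
  intro h
  unfold Eq340Printed at h
  rw [eq340 d N nc ak ℓ hη hM, factor340_eq d N hη] at h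
  -- the common positive factors
  have hP : 0 < (B1RT.prec ak ℓ d / (2 * π)) ^ ((N : ℝ) / 2 * (nc : ℝ)) :=
    Real.rpow_pos_of_pos (div_pos (B1RT.prec_pos hak hℓ d) (by positivity)) _
  have hL : 0 < ℓ ^ (-((N : ℝ) * ((d : ℝ) - 2) / 2) * (Fintype.card T : ℝ)) := Real.rpow_pos_of_pos hℓ _
  have hF : 0 < (2 * π * η ^ d) ^ (-((N : ℝ) / 2 * (Fintype.card T : ℝ))) :=
    Real.rpow_pos_of_pos (mul_pos (by positivity) (pow_pos hη d)) _
  have hD : 0 < MAη.det ^ (-(1 / 2 : ℝ)) := Real.rpow_pos_of_pos hM.det_pos _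
  -- `(2π)^{N|T|} > 1`
  have hcard : 0 < (N : ℝ) * (Fintype.card T : ℝ) := by
    have h1 : (0 : ℝ) < N := by exact_mod_cast hN
    have h2 : (0 : ℝ) < Fintype.card T := by exact_mod_cast Fintype.card_pos
    exact mul_pos h1 h2
  have hbig : 1 < (2 * π) ^ ((N : ℝ) * (Fintype.card T : ℝ)) :=
    Real.one_lt_rpow (by linarith [Real.pi_gt_three]) hcard
  -- cancel and compare: `X = c·X` with `X > 0` forces `c = 1`
  have hX : 0 < (B1RT.prec ak ℓ d / (2 * π)) ^ ((N : ℝ) / 2 * (nc : ℝ))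
      * ℓ ^ (-((N : ℝ) * ((d : ℝ) - 2) / 2) * (Fintype.card T : ℝ))
      * (2 * π * η ^ d) ^ (-((N : ℝ) / 2 * (Fintype.card T : ℝ))) * MAη.det ^ (-(1 / 2 : ℝ)) :=
    mul_pos (mul_pos (mul_pos hP hL) hF) hD
  have key : (B1RT.prec ak ℓ d / (2 * π)) ^ ((N : ℝ) / 2 * (nc : ℝ))
      * ℓ ^ (-((N : ℝ) * ((d : ℝ) - 2) / 2) * (Fintype.card T : ℝ))
      * ((2 * π) ^ ((N : ℝ) * (Fintype.card T : ℝ))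
          * (2 * π * η ^ d) ^ (-((N : ℝ) / 2 * (Fintype.card T : ℝ)))) * MAη.det ^ (-(1 / 2 : ℝ))
      = (2 * π) ^ ((N : ℝ) * (Fintype.card T : ℝ))
        * ((B1RT.prec ak ℓ d / (2 * π)) ^ ((N : ℝ) / 2 * (nc : ℝ))
          * ℓ ^ (-((N : ℝ) * ((d : ℝ) - 2) / 2) * (Fintype.card T : ℝ))
          * (2 * π * η ^ d) ^ (-((N : ℝ) / 2 * (Fintype.card T : ℝ))) * MAη.det ^ (-(1 / 2 : ℝ))) := by
    ring
  rw [key] at h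
  -- `c * X = X`, `X ≠ 0` ⇒ `c = 1`
  have hone : (2 * π) ^ ((N : ℝ) * (Fintype.card T : ℝ)) = 1 := by
    apply mul_right_cancel₀ hX.ne'
    rw [one_mul]
    exact h
  exact absurd hone hbig.ne'

/-! ## §4 Closed forms in use: `log Z_k(A^{(k)})` of (3.38), the evaluation of (3.39), and the (1.22) dictionary -/

/-- **`log Z_k(A^{(k)})`** — the constant entering (3.38) — in closed form from the repaired (3.40):
`(N|T₁^{(k)}|/2)·log(a_k(L^kε)^{d−2}/2π) − (N(d−2)/2)|T₁|·log(L^kε) + (N|T₁|/2)·log(2π/η^d) − ½·log det G_k(A^{(k)})⁻¹`.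
[cite: Balaban1982Higgs1, (3.38)–(3.40) p.619] -/
theorem log_ZAeta (d N nc : ℕ) {ak ℓ η : ℝ} (hak : 0 < ak) (hℓ : 0 < ℓ) (hη : 0 < η)
    {MAη : Matrix (T × Fin N) (T × Fin N) ℝ} (hM : MAη.PosDef) :
    Real.log (ZAeta d N nc ak ℓ η MAη)
      = (N : ℝ) / 2 * (nc : ℝ) * Real.log (B1RT.prec ak ℓ d / (2 * π))
        - (N : ℝ) * ((d : ℝ) - 2) / 2 * (Fintype.card T : ℝ) * Real.log ℓ
        + (N : ℝ) / 2 * (Fintype.card T : ℝ) * Real.log (2 * π / η ^ d)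
        - 1 / 2 * Real.log MAη.det := by
  have hp : 0 < B1RT.prec ak ℓ d / (2 * π) := div_pos (B1RT.prec_pos hak hℓ d) (by positivity)
  have hq : 0 < 2 * π / η ^ d := div_pos (by positivity) (pow_pos hη d)
  have hP : 0 < (B1RT.prec ak ℓ d / (2 * π)) ^ ((N : ℝ) / 2 * (nc : ℝ)) := Real.rpow_pos_of_pos hp _
  have hL : 0 < ℓ ^ (-((N : ℝ) * ((d : ℝ) - 2) / 2) * (Fintype.card T : ℝ)) := Real.rpow_pos_of_pos hℓ _
  have hF : 0 < (2 * π / η ^ d) ^ ((N : ℝ) / 2 * (Fintype.card T : ℝ)) := Real.rpow_pos_of_pos hq _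
  have hD : 0 < MAη.det ^ (-(1 / 2 : ℝ)) := Real.rpow_pos_of_pos hM.det_pos _
  rw [eq340 d N nc ak ℓ hη hM, Real.log_mul (mul_pos (mul_pos hP hL) hF).ne' hD.ne',
    Real.log_mul (mul_pos hP hL).ne' hF.ne', Real.log_mul hP.ne' hL.ne', Real.log_rpow hp, Real.log_rpow hℓ,
    Real.log_rpow hq, Real.log_rpow hM.det_pos]
  ring

/-- the same Gaussian evaluation for **(3.39)** (the print evaluates only (3.40)): for `η > 0` and `G_k⁻¹` positive definite,
`Z_k = (a_k(L^kε)^{d−2}/2π)^{(d/2)|T₁^{(k)}|} (L^kε)^{−(d(d−2)/2)|T₁|} (2π/η^d)^{½d|T₁|} (det G_k⁻¹)^{−1/2}`.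
[cite: Balaban1982Higgs1, (3.39)–(3.40) p.619] -/
theorem Zeta_eq (d nc : ℕ) (ak ℓ : ℝ) {η : ℝ} (hη : 0 < η) {Mη : Matrix (T × Fin d) (T × Fin d) ℝ}
    (hM : Mη.PosDef) :
    Zeta d nc ak ℓ η Mη
      = (B1RT.prec ak ℓ d / (2 * π)) ^ ((d : ℝ) / 2 * (nc : ℝ))
        * ℓ ^ (-((d : ℝ) * ((d : ℝ) - 2) / 2) * (Fintype.card T : ℝ))
        * (2 * π / η ^ d) ^ ((d : ℝ) / 2 * (Fintype.card T : ℝ)) * Mη.det ^ (-(1 / 2 : ℝ)) := by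
  have hexp : ((Fintype.card (T × Fin d) : ℝ) / 2) = (d : ℝ) / 2 * (Fintype.card T : ℝ) := by
    rw [Fintype.card_prod, Fintype.card_fin]
    push_cast
    ring
  have hsq : ∀ x : ℝ, x / Real.sqrt Mη.det = x * Mη.det ^ (-(1 / 2 : ℝ)) := fun x => by
    rw [Real.sqrt_eq_rpow, Real.rpow_neg hM.det_pos.le, div_eq_mul_inv]
  rw [Zeta, gaussInt_eq hη d hM, hexp, hsq]
  ring

end Printed

/-- dictionary to the (1.22) carrier of record (`HiggsRescaling.rescaleScalar`, typer): with `s = ℓ⁻¹` (from the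
`ε`-lattice to the `η = ε/ℓ`-lattice, `ℓ = L^kε`) the canonical rescaling multiplies the field by `ℓ^{−(d−2)/2}` — the
substitution `v = ℓ^{−(d−2)/2}w` of `gaussInt_rescale`. [cite: Balaban1982Higgs1, (1.22) p.607] -/
theorem rescaleScalar_factor {P : HiggsLattice.Params} {k N : ℕ} {ℓ : ℝ} (hℓ : 0 < ℓ)
    (φ' : HiggsLattice.ScalarField (P.scaleBy ℓ⁻¹ (inv_pos.2 hℓ)) k N) (x : HiggsLattice.Site P k) :
    HiggsRescaling.rescaleScalar (inv_pos.2 hℓ) φ' x = (ℓ ^ (-(((P.d : ℝ) - 2) / 2))) • φ' x := by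
  simp only [HiggsRescaling.rescaleScalar, Real.inv_rpow hℓ.le, Real.rpow_neg hℓ.le]

end Literature.MathematicalPhysics.QuantumFieldTheory.Balaban1983to89.B1GaussNorm339

end
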